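import Summits.QuantumFields.YangMills.Theorems.ColdStartUniversalityLatticeLangevinFramePointwiseBochner
import Mathlib.MeasureTheory.Integral.Bochner.Basic
import HarnessLib

/-!
# Route `ColdStartUniversality` (fixed-cut-off package, Bakry–Émery side, log-Sobolev half): the ENTROPIC (`e^h`-weighted)
# integrated `Γ₂` identity for a frame generator

Helper file (seat `ym-line-csu-p1`, g26; `--supports stmt-QuantumFields-24809`).  Abstract setting of `…FrameCalculus` /
`…FrameBochner` / `…FramePointwiseBochner` (frame `s`, structure tensor `c` antisymmetric in its last two slots, potential `ψ`, frame
generator `𝓛f = Σ_n (W_nW_n f + W_nψ · W_n f)`, `Γ(f) = Σ_n (W_n f)²`), plus a measure `ν` on `X` read through `co : X → E` with the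
integration-by-parts identity `∫ (W_nA) B dν = −∫ A (W_nB) dν − ∫ A B (W_nψ) dν` of `…FrameBochner`.
★★ `integral_exp_mul_frameGammaTwo_eq` — for `h ∈ C³`, `ψ ∈ C²`:
    `∫ e^h (𝓛h + Γh)(2𝓛h + Γh) dν = 2 Σ_{n,m} ∫ e^h (W_mW_n h)² dν − 2 Σ_{n,m} ∫ e^h W_nh W_mh W_nW_mψ dν`,
i.e. (`𝓛e^h = e^h(𝓛h + Γh)`) `∫ 𝓛(e^h)·𝓛h dν + ∫ (𝓛e^h)²/e^h dν = 2 ∫ e^h Γ₂(h) dν` — minus the time-derivative of the Fisher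
information `I(P_tf) = ∫ Γ(P_tf)/P_tf` along the semigroup, the identity behind `I' ≤ −2ρ I` under `CD(ρ,∞)` (Bakry–Émery 1985;
Bakry–Gentil–Ledoux 2014, proof of Prop. 5.7.3 / (5.7.4)).  Proof: the pointwise Bochner formula integrated against `e^h dν` and two
applications of the energy identity `∫ (𝓛A) B dν = −Σ_n ∫ W_nA W_nB dν`.
THEOREMS ONLY, no definition, no sorry; [folklore].  HONEST FRAMING: abstract calculus; no statement about Yang–Mills; nothing K-uniform;
the YM mass gap is NOT proved.
-/

set_option autoImplicit false

noncomputable section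

namespace Summit.QuantumFields.YangMills.Theorems.ColdStartUniversality

open Finset MeasureTheory
open scoped BigOperators

variable {E : Type*} [NormedAddCommGroup E] [NormedSpace ℝ E]
variable {X : Type*} [MeasurableSpace X]
variable {ι : Type*} [Fintype ι]

/-! ## §3. The entropic integrated `Γ₂` identity -/

/-- ★★ **Entropic integrated `Γ₂` identity.**  For a frame `s` with bracket relation and antisymmetric structure tensor as in
`frameGammaTwo_pointwise`, a `C²` potential `ψ`, a measure `ν` read through `co : X → E` satisfying the integration-by-parts
hypothesis `∫ (W_nA) B dν = −∫ A (W_nB) dν − ∫ A B (W_nψ) dν` (`C¹` `A, B`), and `h ∈ C³`: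
`∫ e^h (𝓛h + Γh)(2𝓛h + Γh) dν = 2 Σ_{n,m} ∫ e^h (W_mW_n h)² dν − 2 Σ_{n,m} ∫ e^h W_nh W_mh W_nW_mψ dν`.
Since `𝓛(e^h) = e^h(𝓛h + Γh)`, the left side is `∫ 𝓛(e^h)·𝓛h dν + ∫ (𝓛e^h)²/e^h dν`, and the right side is `2∫ e^h Γ₂(h) dν` by the
pointwise Bochner formula: this is (minus) the time-derivative of the Fisher information `∫ Γ(P_tf)/P_tf` along the semigroup
(Bakry–Gentil–Ledoux 2014, proof of Thm 5.7.4 / (5.7.4)). [folklore] -/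
theorem integral_exp_mul_frameGammaTwo_eq (ν : Measure X) (co : X → E) (s : ι → E →L[ℝ] E) (ψ : E → ℝ)
    (c : ι → ι → ι → ℝ) (hs : ∀ n m y, s m (s n y) - s n (s m y) = ∑ k, c n m k • s k y)
    (hc : ∀ n m k, c n m k = -c n k m)
    (hint : ∀ F : E → ℝ, Continuous F → Integrable (fun x => F (co x)) ν)
    (hIBP : ∀ (n : ι) (A B : E → ℝ), ContDiff ℝ 1 A → ContDiff ℝ 1 B →
      ∫ x, fderiv ℝ A (co x) (s n (co x)) * B (co x) ∂ν =
        -∫ x, A (co x) * fderiv ℝ B (co x) (s n (co x)) ∂ν -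
          ∫ x, A (co x) * B (co x) * fderiv ℝ ψ (co x) (s n (co x)) ∂ν)
    (hψ : ContDiff ℝ 2 ψ) {h : E → ℝ} (hh : ContDiff ℝ 3 h) :
    ∫ x, Real.exp (h (co x)) *
        ((∑ n, (fderiv ℝ (fun w => fderiv ℝ h w (s n w)) (co x) (s n (co x)) +
            fderiv ℝ ψ (co x) (s n (co x)) * fderiv ℝ h (co x) (s n (co x)))) +
          ∑ n, (fderiv ℝ h (co x) (s n (co x))) ^ 2) *
        (2 * (∑ n, (fderiv ℝ (fun w => fderiv ℝ h w (s n w)) (co x) (s n (co x)) +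
            fderiv ℝ ψ (co x) (s n (co x)) * fderiv ℝ h (co x) (s n (co x)))) +
          ∑ n, (fderiv ℝ h (co x) (s n (co x))) ^ 2) ∂ν =
      2 * (∑ n, ∑ m, ∫ x, Real.exp (h (co x)) * (fderiv ℝ (fun z => fderiv ℝ h z (s n z)) (co x) (s m (co x))) ^ 2 ∂ν) -
        2 * (∑ n, ∑ m, ∫ x, Real.exp (h (co x)) * (fderiv ℝ h (co x) (s n (co x)) * fderiv ℝ h (co x) (s m (co x)) *
          fderiv ℝ (fun z => fderiv ℝ ψ z (s m z)) (co x) (s n (co x))) ∂ν) := by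
  have hh2 : ContDiff ℝ 2 h := hh.of_le (by norm_num)
  have hh1 : ContDiff ℝ 1 h := hh.of_le (by norm_num)
  have hψ1 : ContDiff ℝ 1 ψ := hψ.of_le (by norm_num)
  -- the players: `e^h ∈ C³`, `Γh ∈ C²`, `𝓛h ∈ C¹`
  have hE3 : ContDiff ℝ 3 (fun z => Real.exp (h z)) := Real.contDiff_exp.comp hh
  have hE2 : ContDiff ℝ 2 (fun z => Real.exp (h z)) := hE3.of_le (by norm_num)
  have hE1 : ContDiff ℝ 1 (fun z => Real.exp (h z)) := hE3.of_le (by norm_num)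
  have hW2 : ∀ m, ContDiff ℝ 2 (fun z => fderiv ℝ h z (s m z)) := fun m => contDiff_frameDeriv (k := 2) hh (s m)
  have hΓ2 : ContDiff ℝ 2 (fun w => ∑ m, (fderiv ℝ h w (s m w)) ^ 2) := ContDiff.sum fun m _ => (hW2 m).pow 2
  have hΓ1 : ContDiff ℝ 1 (fun w => ∑ m, (fderiv ℝ h w (s m w)) ^ 2) := hΓ2.of_le (by norm_num)
  have hL1 : ContDiff ℝ 1 (fun z => ∑ n, (fderiv ℝ (fun w => fderiv ℝ h w (s n w)) z (s n z) +
      fderiv ℝ ψ z (s n z) * fderiv ℝ h z (s n z))) := contDiff_frameGen (k := 1) hh hψ s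
  -- continuity
  have cE : Continuous (fun z => Real.exp (h z)) := hE1.continuous
  have cWh : ∀ n, Continuous (fun z => fderiv ℝ h z (s n z)) := fun n => (hW2 n).continuous
  have cWWh : ∀ n m, Continuous (fun z => fderiv ℝ (fun w => fderiv ℝ h w (s n w)) z (s m z)) :=
    fun n m => (contDiff_frameDeriv (k := 1) (hW2 n) (s m)).continuous
  have cWψ : ∀ n, Continuous (fun z => fderiv ℝ ψ z (s n z)) := fun n => (contDiff_frameDeriv (k := 1) hψ (s n)).continuous
  have cWWψ : ∀ n m, Continuous (fun z => fderiv ℝ (fun w => fderiv ℝ ψ w (s n w)) z (s m z)) :=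
    fun n m => continuous_frameDeriv (contDiff_frameDeriv (k := 1) hψ (s n)) (s m)
  have cΓ : Continuous (fun w => ∑ m, (fderiv ℝ h w (s m w)) ^ 2) := hΓ1.continuous
  have cL : Continuous (fun z => ∑ n, (fderiv ℝ (fun w => fderiv ℝ h w (s n w)) z (s n z) +
      fderiv ℝ ψ z (s n z) * fderiv ℝ h z (s n z))) := hL1.continuous
  have cWΓ : ∀ n, Continuous (fun z => fderiv ℝ (fun w => ∑ m, (fderiv ℝ h w (s m w)) ^ 2) z (s n z)) :=
    fun n => continuous_frameDeriv hΓ1 (s n)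
  have cWL : ∀ n, Continuous (fun z => fderiv ℝ (fun z' => ∑ m, (fderiv ℝ (fun w => fderiv ℝ h w (s m w)) z' (s m z') +
      fderiv ℝ ψ z' (s m z') * fderiv ℝ h z' (s m z'))) z (s n z)) := fun n => continuous_frameDeriv hL1 (s n)
  have cWE : ∀ n, Continuous (fun z => fderiv ℝ (fun z' => Real.exp (h z')) z (s n z)) :=
    fun n => continuous_frameDeriv hE1 (s n)
  -- pointwise: `𝓛(e^h) = e^h (𝓛h + Γh)` and `W_n e^h = e^h W_n h`
  have hLexp : ∀ y, ∑ n, (fderiv ℝ (fun z => fderiv ℝ (fun z' => Real.exp (h z')) z (s n z)) y (s n y) +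
        fderiv ℝ ψ y (s n y) * fderiv ℝ (fun z' => Real.exp (h z')) y (s n y)) =
      Real.exp (h y) * ((∑ n, (fderiv ℝ (fun z => fderiv ℝ h z (s n z)) y (s n y) +
        fderiv ℝ ψ y (s n y) * fderiv ℝ h y (s n y))) + ∑ n, (fderiv ℝ h y (s n y)) ^ 2) :=
    fun y => frameGen_exp ψ hh2 s y
  have hWexp : ∀ n y, fderiv ℝ (fun z' => Real.exp (h z')) y (s n y) = Real.exp (h y) * fderiv ℝ h y (s n y) :=
    fun n y => frameDeriv_exp ((hh.differentiable (by norm_num)) y) (s n y)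
  -- (i) `∫ e^h 𝓛(Γh) = ∫ 𝓛(e^h) Γh` (symmetry, twice the energy identity)
  have hsym1 := integral_frameGen_mul_eq_neg_sum ν co s ψ hint hIBP hψ1 hΓ2 hE1
  have hsym2 := integral_frameGen_mul_eq_neg_sum ν co s ψ hint hIBP hψ1 hE2 hΓ1
  have hi : ∫ x, (∑ n, (fderiv ℝ (fun w => fderiv ℝ (fun w' => ∑ m, (fderiv ℝ h w' (s m w')) ^ 2) w (s n w)) (co x) (s n (co x)) +
        fderiv ℝ ψ (co x) (s n (co x)) * fderiv ℝ (fun w' => ∑ m, (fderiv ℝ h w' (s m w')) ^ 2) (co x) (s n (co x)))) *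
        Real.exp (h (co x)) ∂ν =
      ∫ x, (∑ n, (fderiv ℝ (fun w => fderiv ℝ (fun z' => Real.exp (h z')) w (s n w)) (co x) (s n (co x)) +
        fderiv ℝ ψ (co x) (s n (co x)) * fderiv ℝ (fun z' => Real.exp (h z')) (co x) (s n (co x)))) *
        (∑ m, (fderiv ℝ h (co x) (s m (co x))) ^ 2) ∂ν := by
    rw [hsym1, hsym2]
    congr 1
    refine Finset.sum_congr rfl fun n _ => ?_
    refine integral_congr_ae (Filter.Eventually.of_forall fun x => ?_)
    ring
  -- (ii) `∫ e^h Γ(h, 𝓛h) = Σ_n ∫ W_n(e^h) W_n(𝓛h) = −∫ 𝓛(e^h) 𝓛h`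
  have hsym3 := integral_frameGen_mul_eq_neg_sum ν co s ψ hint hIBP hψ1 hE2 hL1
  -- assemble: express everything through `A := 𝓛h`, `G := Γh` pointwise and the two identities
  have hpt := fun x => frameGammaTwo_pointwise hh hψ s c hs hc (co x)
  -- integrability of all pieces
  have iLG : Integrable (fun x => (∑ n, (fderiv ℝ (fun w => fderiv ℝ (fun w' => ∑ m, (fderiv ℝ h w' (s m w')) ^ 2) w (s n w))
      (co x) (s n (co x)) + fderiv ℝ ψ (co x) (s n (co x)) *
        fderiv ℝ (fun w' => ∑ m, (fderiv ℝ h w' (s m w')) ^ 2) (co x) (s n (co x)))) * Real.exp (h (co x))) ν :=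
    hint _ ((contDiff_frameGen (k := 0) hΓ2 hψ1 s).continuous.mul cE)
  have iG2 : Integrable (fun x => Real.exp (h (co x)) * (∑ n, fderiv ℝ h (co x) (s n (co x)) *
      fderiv ℝ (fun z' => ∑ m, (fderiv ℝ (fun w => fderiv ℝ h w (s m w)) z' (s m z') +
        fderiv ℝ ψ z' (s m z') * fderiv ℝ h z' (s m z'))) (co x) (s n (co x)))) ν :=
    hint _ (cE.mul (continuous_finsetSum _ fun n _ => (cWh n).mul (cWL n)))
  have iSq : ∀ n m, Integrable (fun x => Real.exp (h (co x)) *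
      (fderiv ℝ (fun z => fderiv ℝ h z (s n z)) (co x) (s m (co x))) ^ 2) ν :=
    fun n m => hint _ (cE.mul ((cWWh n m).pow 2))
  have iHs : ∀ n m, Integrable (fun x => Real.exp (h (co x)) * (fderiv ℝ h (co x) (s n (co x)) *
      fderiv ℝ h (co x) (s m (co x)) * fderiv ℝ (fun z => fderiv ℝ ψ z (s m z)) (co x) (s n (co x)))) ν :=
    fun n m => hint _ (cE.mul (((cWh n).mul (cWh m)).mul (cWWψ m n)))
  -- the integral of the pointwise Bochner identity, weighted by `e^h`
  have hBoch : ∫ x, Real.exp (h (co x)) * ((1 / 2 : ℝ) * ∑ n, (fderiv ℝ (fun z => fderiv ℝ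
        (fun w => ∑ m, (fderiv ℝ h w (s m w)) ^ 2) z (s n z)) (co x) (s n (co x)) +
        fderiv ℝ ψ (co x) (s n (co x)) * fderiv ℝ (fun w => ∑ m, (fderiv ℝ h w (s m w)) ^ 2) (co x) (s n (co x))) -
      ∑ n, fderiv ℝ h (co x) (s n (co x)) *
        fderiv ℝ (fun z => ∑ m, (fderiv ℝ (fun w => fderiv ℝ h w (s m w)) z (s m z) +
          fderiv ℝ ψ z (s m z) * fderiv ℝ h z (s m z))) (co x) (s n (co x))) ∂ν =
      (∑ n, ∑ m, ∫ x, Real.exp (h (co x)) * (fderiv ℝ (fun z => fderiv ℝ h z (s n z)) (co x) (s m (co x))) ^ 2 ∂ν) -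
        ∑ n, ∑ m, ∫ x, Real.exp (h (co x)) * (fderiv ℝ h (co x) (s n (co x)) * fderiv ℝ h (co x) (s m (co x)) *
          fderiv ℝ (fun z => fderiv ℝ ψ z (s m z)) (co x) (s n (co x))) ∂ν := by
    have h1 : ∀ x, Real.exp (h (co x)) * ((1 / 2 : ℝ) * ∑ n, (fderiv ℝ (fun z => fderiv ℝ
        (fun w => ∑ m, (fderiv ℝ h w (s m w)) ^ 2) z (s n z)) (co x) (s n (co x)) +
        fderiv ℝ ψ (co x) (s n (co x)) * fderiv ℝ (fun w => ∑ m, (fderiv ℝ h w (s m w)) ^ 2) (co x) (s n (co x))) -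
      ∑ n, fderiv ℝ h (co x) (s n (co x)) *
        fderiv ℝ (fun z => ∑ m, (fderiv ℝ (fun w => fderiv ℝ h w (s m w)) z (s m z) +
          fderiv ℝ ψ z (s m z) * fderiv ℝ h z (s m z))) (co x) (s n (co x))) =
      ∑ n, ∑ m, Real.exp (h (co x)) * (fderiv ℝ (fun z => fderiv ℝ h z (s n z)) (co x) (s m (co x))) ^ 2 -
        ∑ n, ∑ m, Real.exp (h (co x)) * (fderiv ℝ h (co x) (s n (co x)) * fderiv ℝ h (co x) (s m (co x)) *
          fderiv ℝ (fun z => fderiv ℝ ψ z (s m z)) (co x) (s n (co x))) := by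
      intro x
      rw [hpt x, mul_sub, Finset.mul_sum, Finset.mul_sum]
      simp only [Finset.mul_sum]
    simp_rw [h1]
    rw [integral_sub (integrable_finsetSum _ fun n _ => integrable_finsetSum _ fun m _ => iSq n m)
      (integrable_finsetSum _ fun n _ => integrable_finsetSum _ fun m _ => iHs n m),
      integral_finsetSum _ fun n _ => integrable_finsetSum _ fun m _ => iSq n m,
      integral_finsetSum _ fun n _ => integrable_finsetSum _ fun m _ => iHs n m]
    congr 1
    · exact Finset.sum_congr rfl fun n _ => integral_finsetSum _ fun m _ => iSq n m
    · exact Finset.sum_congr rfl fun n _ => integral_finsetSum _ fun m _ => iHs n m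
  -- the left side of the goal, pointwise: `e^h (A + G)(2A + G) = 2·[½ e^h 𝓛G − e^h Γ(h,A)] + (corrections that integrate to it)`;
  -- we organise the computation through the three integrals `J1 = ∫ 𝓛G·e^h`, `J2 = ∫ e^h Σ_n W_nh W_nA`, and the identities.
  obtain ⟨J1, hJ1⟩ : ∃ J1 : ℝ, J1 = ∫ x, (∑ n, (fderiv ℝ (fun w => fderiv ℝ (fun w' => ∑ m, (fderiv ℝ h w' (s m w')) ^ 2) w (s n w)) (co x)
      (s n (co x)) + fderiv ℝ ψ (co x) (s n (co x)) *
        fderiv ℝ (fun w' => ∑ m, (fderiv ℝ h w' (s m w')) ^ 2) (co x) (s n (co x)))) * Real.exp (h (co x)) ∂ν := ⟨_, rfl⟩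
  obtain ⟨J2, hJ2⟩ : ∃ J2 : ℝ, J2 = ∫ x, Real.exp (h (co x)) * (∑ n, fderiv ℝ h (co x) (s n (co x)) *
      fderiv ℝ (fun z' => ∑ m, (fderiv ℝ (fun w => fderiv ℝ h w (s m w)) z' (s m z') +
        fderiv ℝ ψ z' (s m z') * fderiv ℝ h z' (s m z'))) (co x) (s n (co x))) ∂ν := ⟨_, rfl⟩
  have iWEL : ∀ n, Integrable (fun x => fderiv ℝ (fun z' => Real.exp (h z')) (co x) (s n (co x)) *
      fderiv ℝ (fun z' => ∑ m, (fderiv ℝ (fun w => fderiv ℝ h w (s m w)) z' (s m z') +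
        fderiv ℝ ψ z' (s m z') * fderiv ℝ h z' (s m z'))) (co x) (s n (co x))) ν :=
    fun n => hint _ ((cWE n).mul (cWL n))
  -- `J1 = ∫ e^h (A+G) G`
  have eJ1 : J1 = ∫ x, Real.exp (h (co x)) * (((∑ n, (fderiv ℝ (fun w => fderiv ℝ h w (s n w)) (co x) (s n (co x)) +
        fderiv ℝ ψ (co x) (s n (co x)) * fderiv ℝ h (co x) (s n (co x)))) +
        ∑ n, (fderiv ℝ h (co x) (s n (co x))) ^ 2) * ∑ m, (fderiv ℝ h (co x) (s m (co x))) ^ 2) ∂ν := by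
    rw [hJ1, hi]
    refine integral_congr_ae (Filter.Eventually.of_forall fun x => ?_)
    beta_reduce
    rw [hLexp (co x)]
    ring
  -- `J2 = −∫ e^h (A+G) A`
  have eJ2 : J2 = -∫ x, Real.exp (h (co x)) * (((∑ n, (fderiv ℝ (fun w => fderiv ℝ h w (s n w)) (co x) (s n (co x)) +
        fderiv ℝ ψ (co x) (s n (co x)) * fderiv ℝ h (co x) (s n (co x)))) +
        ∑ n, (fderiv ℝ h (co x) (s n (co x))) ^ 2) *
        ∑ m, (fderiv ℝ (fun w => fderiv ℝ h w (s m w)) (co x) (s m (co x)) +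
          fderiv ℝ ψ (co x) (s m (co x)) * fderiv ℝ h (co x) (s m (co x)))) ∂ν := by
    have h3 : ∫ x, (∑ n, (fderiv ℝ (fun w => fderiv ℝ (fun z' => Real.exp (h z')) w (s n w)) (co x) (s n (co x)) +
        fderiv ℝ ψ (co x) (s n (co x)) * fderiv ℝ (fun z' => Real.exp (h z')) (co x) (s n (co x)))) *
        (∑ m, (fderiv ℝ (fun w => fderiv ℝ h w (s m w)) (co x) (s m (co x)) +
          fderiv ℝ ψ (co x) (s m (co x)) * fderiv ℝ h (co x) (s m (co x)))) ∂ν =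
        -∑ n, ∫ x, fderiv ℝ (fun z' => Real.exp (h z')) (co x) (s n (co x)) *
          fderiv ℝ (fun z' => ∑ m, (fderiv ℝ (fun w => fderiv ℝ h w (s m w)) z' (s m z') +
            fderiv ℝ ψ z' (s m z') * fderiv ℝ h z' (s m z'))) (co x) (s n (co x)) ∂ν := hsym3
    have h4 : J2 = ∑ n, ∫ x, fderiv ℝ (fun z' => Real.exp (h z')) (co x) (s n (co x)) *
          fderiv ℝ (fun z' => ∑ m, (fderiv ℝ (fun w => fderiv ℝ h w (s m w)) z' (s m z') +
            fderiv ℝ ψ z' (s m z') * fderiv ℝ h z' (s m z'))) (co x) (s n (co x)) ∂ν := by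
      rw [hJ2, ← integral_finsetSum _ fun n _ => iWEL n]
      refine integral_congr_ae (Filter.Eventually.of_forall fun x => ?_)
      beta_reduce
      rw [Finset.mul_sum]
      refine Finset.sum_congr rfl fun n _ => ?_
      rw [hWexp n (co x)]
      ring
    rw [h4, ← neg_neg (∑ n, _), ← h3]
    congr 1
    refine integral_congr_ae (Filter.Eventually.of_forall fun x => ?_)
    beta_reduce
    rw [hLexp (co x)]
    ring
  -- `hBoch` says `½ J1 − J2 = RHS/2`
  have eB : (1 / 2 : ℝ) * J1 - J2 =
      (∑ n, ∑ m, ∫ x, Real.exp (h (co x)) * (fderiv ℝ (fun z => fderiv ℝ h z (s n z)) (co x) (s m (co x))) ^ 2 ∂ν) -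
        ∑ n, ∑ m, ∫ x, Real.exp (h (co x)) * (fderiv ℝ h (co x) (s n (co x)) * fderiv ℝ h (co x) (s m (co x)) *
          fderiv ℝ (fun z => fderiv ℝ ψ z (s m z)) (co x) (s n (co x))) ∂ν := by
    rw [← hBoch, hJ1, hJ2, ← integral_const_mul, ← integral_sub (iLG.const_mul _) iG2]
    refine integral_congr_ae (Filter.Eventually.of_forall fun x => ?_)
    ring
  -- and the goal's left side is `J1 + 2·(−J2)` after expanding `(A+G)(2A+G) = (A+G)G + 2(A+G)A`
  have iP1 : Integrable (fun x => Real.exp (h (co x)) * (((∑ n, (fderiv ℝ (fun w => fderiv ℝ h w (s n w)) (co x) (s n (co x)) +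
        fderiv ℝ ψ (co x) (s n (co x)) * fderiv ℝ h (co x) (s n (co x)))) +
        ∑ n, (fderiv ℝ h (co x) (s n (co x))) ^ 2) * ∑ m, (fderiv ℝ h (co x) (s m (co x))) ^ 2)) ν :=
    hint _ (cE.mul ((cL.add cΓ).mul cΓ))
  have iP2 : Integrable (fun x => Real.exp (h (co x)) * (((∑ n, (fderiv ℝ (fun w => fderiv ℝ h w (s n w)) (co x) (s n (co x)) +
        fderiv ℝ ψ (co x) (s n (co x)) * fderiv ℝ h (co x) (s n (co x)))) +
        ∑ n, (fderiv ℝ h (co x) (s n (co x))) ^ 2) *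
        ∑ m, (fderiv ℝ (fun w => fderiv ℝ h w (s m w)) (co x) (s m (co x)) +
          fderiv ℝ ψ (co x) (s m (co x)) * fderiv ℝ h (co x) (s m (co x))))) ν :=
    hint _ (cE.mul ((cL.add cΓ).mul cL))
  have eGoal : ∫ x, Real.exp (h (co x)) *
        ((∑ n, (fderiv ℝ (fun w => fderiv ℝ h w (s n w)) (co x) (s n (co x)) +
            fderiv ℝ ψ (co x) (s n (co x)) * fderiv ℝ h (co x) (s n (co x)))) +
          ∑ n, (fderiv ℝ h (co x) (s n (co x))) ^ 2) *
        (2 * (∑ n, (fderiv ℝ (fun w => fderiv ℝ h w (s n w)) (co x) (s n (co x)) +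
            fderiv ℝ ψ (co x) (s n (co x)) * fderiv ℝ h (co x) (s n (co x)))) +
          ∑ n, (fderiv ℝ h (co x) (s n (co x))) ^ 2) ∂ν = J1 + 2 * (-J2) := by
    rw [eJ1, eJ2, neg_neg, ← integral_const_mul, ← integral_add iP1 (iP2.const_mul _)]
    refine integral_congr_ae (Filter.Eventually.of_forall fun x => ?_)
    ring
  rw [eGoal]
  linarith [eB]

end Summit.QuantumFields.YangMills.Theorems.ColdStartUniversality
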